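import Summits.CriticalPhenomena.PercolationContinuityZ3.Theorems.PercNearOneGluingNoHeavyLowerTailSahiSharedTwoPointIdentity
import Mathlib.Tactic.Linarith
import Mathlib.Tactic.Ring
import Mathlib.Tactic.FieldSimp
import Mathlib.Tactic.LinearCombination
import HarnessLib

/-!
# `NoHeavyLowerTail` (crux stmt-CriticalPhenomena-4575), P2 — **SAHI'S `C_3` WHEN THE `f`–`g` BLOCK IS A TWO-POINT CHAIN, `h` ARBITRARY** (Lean)

Memo SAHI-ROUTE.md §4.28 (seat `prim-masterthm-p2`, gen 8; `--supports stmt-CriticalPhenomena-4575`).  No `sorry`, no named facts, standard axioms.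
Companion of `…SahiTriangleClassT` (there `h` ignores the block `γ` shared by `f` and `g`; here `h` is UNRESTRICTED but `γ` carries its weight on
two comparable points — for increasing events on a cube: `f` and `g` share at most ONE coordinate, `h` arbitrary).

SETTING.  `α, β` finite distributive lattices with FKG probability weights `wA, wB`; `γ` a finite preorder with a probability weight `wC` supported
on `{c₀, c₁}`, `c₀ ≤ c₁`; `f : γ → α → ℝ`, `g : γ → β → ℝ`, `h : γ → α → β → ℝ` nonnegative and coordinatewise monotone.  (Every triple of monotone
functions on a product of three blocks has this shape once `γ ⊇ supp f ∩ supp g`; nothing is assumed about `h`.)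

**THEOREM (`sahiE_three_nonneg_sharedTwoPoint`).  `E_3(f,g,h) ≥ 0`** under the product weight on `α × β × γ`.

PROOF (SAHI-ROUTE §4.28).  With `Y(c,b) = E_a[f(c,·)h(c,·,b)]`, `F(c) = E_a f(c,·)`, `H(c,b) = E_a h(c,·,b)`, `G(b) = E_c g(·,b)`, `Ȳ(c) = E_b Y(c,·)`,
`EH = E h`, `EF = E f`, the CAPPED RATIO `ρ(c) = min(1, EH·F(c)/Ȳ(c))` and its DEFECT `ψ(c) = EH·F(c) − ρ(c)Ȳ(c) = (EH·F(c) − Ȳ(c))⁺`, the EXACT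
IDENTITY (`sahiE_three_eq` in part 1 `…SahiSharedTwoPointIdentity`, valid for ANY finite `γ` and any probability weight `wC`; it uses only `ρȲ + ψ = EH·F`):
  `E_3 = E_b[Φ + Δ] + E_c[ ρ(c)·Cov_b(g(c,·), Y(c,·)) + (1−ρ(c))·Cov_b(G, Y(c,·)) ]`,
  `Φ(b) = E_c[ g(·,b)((2−ρ)Y(·,b) − EF·H(·,b)) − G(b)(1−ρ)Y(·,b) ]`,  `Δ(b) = −Cov_{wC}(g(·,b), ψ)`.
The covariances are `≥ 0` (FKG on `β`).  On two points `c₀ ≤ c₁` with `w₀ = wC(c₀)`, `w₁ = 1 − w₀`:  `ψ(c₁) = 0` (FKG on `α` gives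
`Ȳ(c₁) ≥ F(c₁)H̄(c₁) ≥ F(c₁)·EH`), so `Δ(b) = w₀w₁(g(c₁,b) − g(c₀,b))ψ(c₀) ≥ 0`; and
`Φ(b) = w₁(g₁−g₀)·A₁ + g₀·S` with `A₁ = w₁(Y₁ − F₁H₁) + w₀[(2−ρ₁)Y₁ − F₀H₁ − (1−ρ₀)Y₀] ≥ 0` (FKG on `α` and the MARGIN
`(2−ρ(c₁))Y(c₁,b) ≥ F(c₀)H(c₁,b) + (1−ρ(c₀))Y(c₀,b)`, which follows from the ratio condition `(⋆) F(c₀) ≤ (1−ρ(c₁)+ρ(c₀))F(c₁)`) and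
`S = w₀(Y₀ − F₀H₀) + w₁(Y₁ − F₁H₁) + w₀w₁(F₁−F₀)(H₁−H₀) ≥ 0`.
-/

noncomputable section

open scoped Classical

namespace Summit.CriticalPhenomena.PercolationContinuityZ3.Theorems

namespace SahiSharedTwoPoint

open Finset
open Literature.Combinatorics.Sahi2008
open SahiTriangleSupermodular (fkg_sum)

section Main

variable {α β γ : Type} [Fintype α] [Fintype β] [Fintype γ]
  {wA : α → ℝ} {wB : β → ℝ} {wC : γ → ℝ} {f : γ → α → ℝ} {g : γ → β → ℝ} {h : γ → α → β → ℝ}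

/-! ### FKG facts, `(⋆)`, the margin, two-point sums -/

omit [Fintype β] [Fintype γ] in
/-- `Y(c,b) ≥ F(c) H(c,b)` (FKG on `α`). [this work] -/
theorem FH_le_Y [DistribLattice α] (hA : IsFKGMeasure wA) (hf0 : ∀ c a, 0 ≤ f c a) (hh0 : ∀ c a b, 0 ≤ h c a b)
    (hfa : ∀ c, Monotone (f c)) (hha : ∀ c b, Monotone (fun a => h c a b)) (c : γ) (b : β) :
    FC wA f c * HH wA h c b ≤ Y wA f h c b := by
  unfold FC HH Y
  exact fkg_sum hA (hf0 c) (fun a => hh0 c a b) (hfa c) (hha c b)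

omit [Fintype γ] in
/-- `Ȳ(c) ≥ F(c) H̄(c)`. [this work] -/
theorem FHbar_le_Ybar [DistribLattice α] (hA : IsFKGMeasure wA) (hB0 : ∀ b, 0 ≤ wB b) (hf0 : ∀ c a, 0 ≤ f c a)
    (hh0 : ∀ c a b, 0 ≤ h c a b) (hfa : ∀ c, Monotone (f c)) (hha : ∀ c b, Monotone (fun a => h c a b)) (c : γ) :
    FC wA f c * Hbar wA wB h c ≤ Ybar wA wB f h c := by
  unfold Hbar Ybar
  rw [mul_sum]
  refine sum_le_sum fun b _ => ?_
  have := FH_le_Y hA hf0 hh0 hfa hha c b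
  have hb := hB0 b
  nlinarith

/-- **`(⋆)` for the capped ratio**: `F(c') ≤ (1 − ρ(c) + ρ(c')) F(c)` for `c' ≤ c`. [this work] -/
theorem star [Preorder γ] (hA0 : ∀ a, 0 ≤ wA a) (hB0 : ∀ b, 0 ≤ wB b) (hC0 : ∀ c, 0 ≤ wC c)
    (hf0 : ∀ c a, 0 ≤ f c a) (hfc : ∀ a, Monotone (fun c => f c a))
    (hh0 : ∀ c a b, 0 ≤ h c a b) (hhc : ∀ a b, Monotone (fun c => h c a b)) {c c' : γ} (hcc : c' ≤ c) :
    FC wA f c' ≤ (1 - rho wA wB wC f h c + rho wA wB wC f h c') * FC wA f c := by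
  obtain ⟨-, hρ1, hψ0, hψρ, hY0ρ, -, hψge⟩ := rho_spec hA0 hB0 hC0 hf0 hh0 (wA := wA) (wB := wB) (wC := wC) (f := f) (h := h) c
  obtain ⟨hρ0', -, -, hψρ', hY0ρ', -, -⟩ := rho_spec hA0 hB0 hC0 hf0 hh0 (wA := wA) (wB := wB) (wC := wC) (f := f) (h := h) c'
  have eψ := rho_psi (wA := wA) (wB := wB) (wC := wC) (f := f) (h := h) c
  have eψ' := rho_psi (wA := wA) (wB := wB) (wC := wC) (f := f) (h := h) c'
  have hF0 : 0 ≤ FC wA f c := sum_nonneg fun a _ => mul_nonneg (hA0 a) (hf0 c a)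
  have hF'0 : 0 ≤ FC wA f c' := sum_nonneg fun a _ => mul_nonneg (hA0 a) (hf0 c' a)
  have hFle : FC wA f c' ≤ FC wA f c := sum_le_sum fun a _ => mul_le_mul_of_nonneg_left (hfc a hcc) (hA0 a)
  have hY'0 : 0 ≤ Ybar wA wB f h c' := sum_nonneg fun b _ => mul_nonneg (hB0 b)
    (sum_nonneg fun a _ => mul_nonneg (hA0 a) (mul_nonneg (hf0 c' a) (hh0 c' a b)))
  have hYle : Ybar wA wB f h c' ≤ Ybar wA wB f h c :=
    sum_le_sum fun b _ => mul_le_mul_of_nonneg_left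
      (sum_le_sum fun a _ => mul_le_mul_of_nonneg_left
        (mul_le_mul (hfc a hcc) (hhc a b hcc) (hh0 c' a b) (hf0 c a)) (hA0 a)) (hB0 b)
  by_cases h1' : rho wA wB wC f h c' = 1
  · rw [h1']
    have := mul_nonneg (sub_nonneg.mpr hρ1) hF0
    nlinarith
  · have hψ' : psi wA wB wC f h c' = 0 := hψρ'.resolve_right h1'
    have hY'pos : 0 < Ybar wA wB f h c' := lt_of_le_of_ne hY'0 (fun h0 => h1' (hY0ρ' h0.symm))
    have e' : rho wA wB wC f h c' * Ybar wA wB f h c' = EH wA wB wC h * FC wA f c' := by rw [← eψ', hψ', add_zero]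
    by_cases h1 : rho wA wB wC f h c = 1
    · rw [h1]
      have hYc : Ybar wA wB f h c ≤ EH wA wB wC h * FC wA f c := by rw [h1, one_mul] at eψ; linarith
      have key : FC wA f c' * Ybar wA wB f h c' ≤ (1 - 1 + rho wA wB wC f h c') * FC wA f c * Ybar wA wB f h c' := by
        have t1 : FC wA f c' * Ybar wA wB f h c' ≤ FC wA f c' * (EH wA wB wC h * FC wA f c) :=
          mul_le_mul_of_nonneg_left (hYle.trans hYc) hF'0
        have t2 : rho wA wB wC f h c' * FC wA f c * Ybar wA wB f h c' = FC wA f c * (EH wA wB wC h * FC wA f c') := by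
          rw [← e']; ring
        nlinarith [t1, t2]
      exact le_of_mul_le_mul_right key hY'pos
    · have hψ : psi wA wB wC f h c = 0 := hψρ.resolve_right h1
      have hYpos : 0 < Ybar wA wB f h c :=
        lt_of_le_of_ne (hY'0.trans hYle) (fun h0 => h1 (hY0ρ h0.symm))
      have e : rho wA wB wC f h c * Ybar wA wB f h c = EH wA wB wC h * FC wA f c := by rw [← eψ, hψ, add_zero]
      have hge : EH wA wB wC h * FC wA f c ≤ Ybar wA wB f h c := by rw [hψ] at hψge; linarith
      have key : FC wA f c' * Ybar wA wB f h c ≤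
          (1 - rho wA wB wC f h c + rho wA wB wC f h c') * FC wA f c * Ybar wA wB f h c := by
        have h2 : rho wA wB wC f h c' * FC wA f c * Ybar wA wB f h c' ≤
            rho wA wB wC f h c' * FC wA f c * Ybar wA wB f h c := mul_le_mul_of_nonneg_left hYle (mul_nonneg hρ0' hF0)
        have e3 : rho wA wB wC f h c' * FC wA f c * Ybar wA wB f h c' = FC wA f c * (EH wA wB wC h * FC wA f c') := by
          rw [← e']; ring
        have eF : FC wA f c * (rho wA wB wC f h c * Ybar wA wB f h c) = FC wA f c * (EH wA wB wC h * FC wA f c) := by rw [e]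
        have h4 : 0 ≤ (FC wA f c - FC wA f c') * (Ybar wA wB f h c - EH wA wB wC h * FC wA f c) :=
          mul_nonneg (sub_nonneg.mpr hFle) (sub_nonneg.mpr hge)
        nlinarith [h2, e3, eF, h4]
      exact le_of_mul_le_mul_right key hYpos

/-- The MARGIN: `F(c') H(c,b) + (1 − ρ(c')) Y(c',b) ≤ (2 − ρ(c)) Y(c,b)` for `c' ≤ c`. [this work] -/
theorem margin [DistribLattice α] [Preorder γ] (hA : IsFKGMeasure wA) (hB0 : ∀ b, 0 ≤ wB b) (hC0 : ∀ c, 0 ≤ wC c)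
    (hf0 : ∀ c a, 0 ≤ f c a) (hfa : ∀ c, Monotone (f c)) (hfc : ∀ a, Monotone (fun c => f c a))
    (hh0 : ∀ c a b, 0 ≤ h c a b) (hhc : ∀ a b, Monotone (fun c => h c a b)) (hha : ∀ c b, Monotone (fun a => h c a b))
    {c c' : γ} (hcc : c' ≤ c) (b : β) :
    FC wA f c' * HH wA h c b + (1 - rho wA wB wC f h c') * Y wA f h c' b ≤ (2 - rho wA wB wC f h c) * Y wA f h c b := by
  have hA0 := hA.nonneg
  obtain ⟨-, hρ1, -⟩ := rho_spec hA0 hB0 hC0 hf0 hh0 (wA := wA) (wB := wB) (wC := wC) (f := f) (h := h) c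
  obtain ⟨hρ0', hρ1', -⟩ := rho_spec hA0 hB0 hC0 hf0 hh0 (wA := wA) (wB := wB) (wC := wC) (f := f) (h := h) c'
  have hYc : Y wA f h c' b ≤ Y wA f h c b := sum_le_sum fun a _ => mul_le_mul_of_nonneg_left
    (mul_le_mul (hfc a hcc) (hhc a b hcc) (hh0 c' a b) (hf0 c a)) (hA0 a)
  have hH0 : 0 ≤ HH wA h c b := sum_nonneg fun a _ => mul_nonneg (hA0 a) (hh0 c a b)
  have h1 : (1 - rho wA wB wC f h c') * Y wA f h c' b ≤ (1 - rho wA wB wC f h c') * Y wA f h c b :=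
    mul_le_mul_of_nonneg_left hYc (by linarith)
  have hc : 0 ≤ 1 - rho wA wB wC f h c + rho wA wB wC f h c' := by linarith
  have h2 : (1 - rho wA wB wC f h c + rho wA wB wC f h c') * (FC wA f c * HH wA h c b) ≤
      (1 - rho wA wB wC f h c + rho wA wB wC f h c') * Y wA f h c b :=
    mul_le_mul_of_nonneg_left (FH_le_Y hA hf0 hh0 hfa hha c b) hc
  have h3 : FC wA f c' * HH wA h c b ≤ (1 - rho wA wB wC f h c + rho wA wB wC f h c') * FC wA f c * HH wA h c b :=
    mul_le_mul_of_nonneg_right (star hA0 hB0 hC0 hf0 hfc hh0 hhc hcc) hH0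
  nlinarith [h1, h2, h3]

omit [Fintype α] [Fintype β] in
/-- A probability weight carried by `{c₀, c₁}`: `Σ_c wC(c) X(c) = wC(c₀) X(c₀) + (1 − wC(c₀)) X(c₁)` (also when `c₀ = c₁`). [folklore] -/
theorem sum_two {c₀ c₁ : γ} (hC1 : ∑ c, wC c = 1) (hsupp : ∀ c, c ≠ c₀ → c ≠ c₁ → wC c = 0) (X : γ → ℝ) :
    ∑ c, wC c * X c = wC c₀ * X c₀ + (1 - wC c₀) * X c₁ := by
  have key : ∀ Z : γ → ℝ, ∑ c, wC c * Z c = ∑ c ∈ ({c₀, c₁} : Finset γ), wC c * Z c := fun Z =>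
    (sum_subset (subset_univ _) fun c _ hc => by
      simp only [mem_insert, mem_singleton, not_or] at hc
      rw [hsupp c hc.1 hc.2, zero_mul]).symm
  have h1 := key fun _ => (1 : ℝ)
  simp only [mul_one, hC1] at h1
  rw [key X]
  by_cases h : c₀ = c₁
  · subst h
    rw [pair_eq_singleton, sum_singleton] at h1 ⊢
    rw [← h1]; ring
  · rw [sum_pair h] at h1 ⊢
    rw [show wC c₁ = 1 - wC c₀ by linarith]

/-! ### The theorem -/

/-- **THEOREM (Sahi's `C_3` when `f` and `g` share a two-point chain, `h` arbitrary).**  `α, β` finite distributive lattices with FKG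
probability weights `wA, wB`; `γ` a finite preorder with a probability weight `wC` carried by two points `c₀ ≤ c₁`; `f : γ → α → ℝ`,
`g : γ → β → ℝ`, `h : γ → α → β → ℝ` nonnegative and coordinatewise monotone.  Then `E_3(f,g,h) ≥ 0` under the product weight on
`α × β × γ`.  (Increasing events on a cube with a product measure: `f` and `g` share at most one coordinate, `h` unrestricted.) [this work] -/
theorem sahiE_three_nonneg_sharedTwoPoint [DistribLattice α] [DistribLattice β] [Preorder γ]
    (hA : IsFKGMeasure wA) (hB : IsFKGMeasure wB) (hC0 : ∀ c, 0 ≤ wC c) (hC1 : ∑ c, wC c = 1)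
    {c₀ c₁ : γ} (h01 : c₀ ≤ c₁) (hsupp : ∀ c, c ≠ c₀ → c ≠ c₁ → wC c = 0)
    (hf0 : ∀ c a, 0 ≤ f c a) (hfa : ∀ c, Monotone (f c)) (hfc : ∀ a, Monotone (fun c => f c a))
    (hg0 : ∀ c b, 0 ≤ g c b) (hgb : ∀ c, Monotone (g c)) (hgc : ∀ b, Monotone (fun c => g c b))
    (hh0 : ∀ c a b, 0 ≤ h c a b) (hhc : ∀ a b, Monotone (fun c => h c a b))
    (hha : ∀ c b, Monotone (fun a => h c a b)) (hhb : ∀ c a, Monotone (h c a)) :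
    0 ≤ sahiE (fun q : α × β × γ => wA q.1 * wB q.2.1 * wC q.2.2) 3
        ![fun q => f q.2.2 q.1, fun q => g q.2.2 q.2.1, fun q => h q.2.2 q.1 q.2.1] := by
  rw [sahiE_three_eq hA.sum_eq_one hB.sum_eq_one]
  have hA0 := hA.nonneg; have hB0 := hB.nonneg
  have hρ := fun c => rho_spec hA0 hB0 hC0 hf0 hh0 (wA := wA) (wB := wB) (wC := wC) (f := f) (h := h) c
  have two : ∀ X : γ → ℝ, ∑ c, wC c * X c = wC c₀ * X c₀ + (1 - wC c₀) * X c₁ := sum_two hC1 hsupp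
  have hw0 : 0 ≤ wC c₀ := hC0 c₀
  have hw1 : 0 ≤ 1 - wC c₀ := by
    have : wC c₀ ≤ ∑ c, wC c := single_le_sum (fun c _ => hC0 c) (mem_univ c₀)
    linarith
  have hY0 : ∀ c b, 0 ≤ Y wA f h c b := fun c b =>
    sum_nonneg fun a _ => mul_nonneg (hA0 a) (mul_nonneg (hf0 c a) (hh0 c a b))
  have hYb : ∀ c, Monotone (Y wA f h c) := fun c b b' hbb =>
    sum_le_sum fun a _ => mul_le_mul_of_nonneg_left (mul_le_mul_of_nonneg_left (hhb c a hbb) (hf0 c a)) (hA0 a)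
  have hF0 : ∀ c, 0 ≤ FC wA f c := fun c => sum_nonneg fun a _ => mul_nonneg (hA0 a) (hf0 c a)
  have hH0 : ∀ c b, 0 ≤ HH wA h c b := fun c b => sum_nonneg fun a _ => mul_nonneg (hA0 a) (hh0 c a b)
  have hG0 : ∀ b, 0 ≤ GG wC g b := fun b => sum_nonneg fun c _ => mul_nonneg (hC0 c) (hg0 c b)
  have hGb : Monotone (GG wC g) := fun b b' hbb => sum_le_sum fun c _ => mul_le_mul_of_nonneg_left (hgb c hbb) (hC0 c)
  -- ψ(c₁) = 0 :  Ȳ(c₁) ≥ F(c₁) H̄(c₁) ≥ F(c₁) EH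
  have hψ1 : psi wA wB wC f h c₁ = 0 := by
    refine (hρ c₁).2.2.2.2.2.1 ?_
    have hHb : Hbar wA wB h c₀ ≤ Hbar wA wB h c₁ := sum_le_sum fun b _ => mul_le_mul_of_nonneg_left
      (sum_le_sum fun a _ => mul_le_mul_of_nonneg_left (hhc a b h01) (hA0 a)) (hB0 b)
    have hEH : EH wA wB wC h ≤ Hbar wA wB h c₁ := by
      unfold EH; rw [two]; nlinarith
    calc EH wA wB wC h * FC wA f c₁ ≤ Hbar wA wB h c₁ * FC wA f c₁ := mul_le_mul_of_nonneg_right hEH (hF0 c₁)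
      _ = FC wA f c₁ * Hbar wA wB h c₁ := mul_comm _ _
      _ ≤ Ybar wA wB f h c₁ := FHbar_le_Ybar hA hB0 hf0 hh0 hfa hha c₁
  -- (1) Φ(b) + Δ(b) ≥ 0 pointwise: explicit two-point computation
  have hPD : ∀ b, 0 ≤ Phi wA wB wC f g h b + Delta wA wB wC f g h b := by
    intro b
    have hm := margin hA hB0 hC0 hf0 hfa hfc hh0 hhc hha h01 b
    have hy1 := FH_le_Y hA hf0 hh0 hfa hha c₁ b
    have hy0 := FH_le_Y hA hf0 hh0 hfa hha c₀ b
    have hF01 : FC wA f c₀ ≤ FC wA f c₁ := sum_le_sum fun a _ => mul_le_mul_of_nonneg_left (hfc a h01) (hA0 a)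
    have hH01 : HH wA h c₀ b ≤ HH wA h c₁ b := sum_le_sum fun a _ => mul_le_mul_of_nonneg_left (hhc a b h01) (hA0 a)
    have hg01 : g c₀ b ≤ g c₁ b := hgc b h01
    have hψ0 : 0 ≤ psi wA wB wC f h c₀ := (hρ c₀).2.2.1
    -- the three nonnegative pieces
    have hA1 : 0 ≤ (1 - wC c₀) * (Y wA f h c₁ b - FC wA f c₁ * HH wA h c₁ b) +
        wC c₀ * ((2 - rho wA wB wC f h c₁) * Y wA f h c₁ b - FC wA f c₀ * HH wA h c₁ b -
          (1 - rho wA wB wC f h c₀) * Y wA f h c₀ b) :=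
      add_nonneg (mul_nonneg hw1 (by linarith)) (mul_nonneg hw0 (by linarith))
    have hS : 0 ≤ wC c₀ * (Y wA f h c₀ b - FC wA f c₀ * HH wA h c₀ b) + (1 - wC c₀) * (Y wA f h c₁ b - FC wA f c₁ * HH wA h c₁ b) +
        wC c₀ * (1 - wC c₀) * ((FC wA f c₁ - FC wA f c₀) * (HH wA h c₁ b - HH wA h c₀ b)) :=
      add_nonneg (add_nonneg (mul_nonneg hw0 (by linarith)) (mul_nonneg hw1 (by linarith)))
        (mul_nonneg (mul_nonneg hw0 hw1) (mul_nonneg (by linarith) (by linarith)))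
    have hT : 0 ≤ wC c₀ * (1 - wC c₀) * (g c₁ b - g c₀ b) * (psi wA wB wC f h c₀ - psi wA wB wC f h c₁) :=
      mul_nonneg (mul_nonneg (mul_nonneg hw0 hw1) (by linarith)) (by rw [hψ1, sub_zero]; exact hψ0)
    have e : Phi wA wB wC f g h b + Delta wA wB wC f g h b =
        (1 - wC c₀) * (g c₁ b - g c₀ b) * ((1 - wC c₀) * (Y wA f h c₁ b - FC wA f c₁ * HH wA h c₁ b) +
          wC c₀ * ((2 - rho wA wB wC f h c₁) * Y wA f h c₁ b - FC wA f c₀ * HH wA h c₁ b -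
            (1 - rho wA wB wC f h c₀) * Y wA f h c₀ b)) +
        g c₀ b * (wC c₀ * (Y wA f h c₀ b - FC wA f c₀ * HH wA h c₀ b) + (1 - wC c₀) * (Y wA f h c₁ b - FC wA f c₁ * HH wA h c₁ b) +
          wC c₀ * (1 - wC c₀) * ((FC wA f c₁ - FC wA f c₀) * (HH wA h c₁ b - HH wA h c₀ b))) +
        wC c₀ * (1 - wC c₀) * (g c₁ b - g c₀ b) * (psi wA wB wC f h c₀ - psi wA wB wC f h c₁) := by
      simp only [Phi, Delta, GG, EF, two]
      ring
    rw [e]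
    exact add_nonneg (add_nonneg (mul_nonneg (mul_nonneg hw1 (by linarith)) hA1) (mul_nonneg (hg0 c₀ b) hS)) hT
  -- (2) covariances ≥ 0 (FKG on β)
  have hcov1 : ∀ c, GC wB g c * Ybar wA wB f h c ≤ ∑ b, wB b * (g c b * Y wA f h c b) :=
    fun c => fkg_sum hB (hg0 c) (hY0 c) (hgb c) (hYb c)
  have hcov2 : ∀ c, Gbar wB wC g * Ybar wA wB f h c ≤ ∑ b, wB b * (GG wC g b * Y wA f h c b) :=
    fun c => fkg_sum hB hG0 (hY0 c) hGb (hYb c)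
  refine add_nonneg (sum_nonneg fun b _ => mul_nonneg (hB0 b) (hPD b)) (sum_nonneg fun c _ => mul_nonneg (hC0 c) (add_nonneg ?_ ?_))
  · exact mul_nonneg (hρ c).1 (sub_nonneg.mpr (hcov1 c))
  · exact mul_nonneg (by linarith [(hρ c).2.1]) (sub_nonneg.mpr (hcov2 c))

end Main

section Cubes

variable {A B C : Type} [Fintype A] [Fintype B] [Fintype C]

/-- **Three Boolean cubes with product (Bernoulli) measures, the shared cube `2^C` a single bit (`C` a subsingleton).**  For ARBITRARY
nonnegative coordinatewise monotone `f : 2^C × 2^A → ℝ`, `g : 2^C × 2^B → ℝ`, `h : 2^C × 2^A × 2^B → ℝ` and any Bernoulli parameters,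
`E_3(f,g,h) ≥ 0`: Kahn's `C_3` for every triple of increasing events in which two of the events share at most one coordinate (group the
remaining coordinates by which of the two ignores them; the third event is unrestricted). [this work] -/
theorem sahiE_three_nonneg_cubes_sharedBit [Subsingleton C] (pA : A → unitInterval) (pB : B → unitInterval) (pC : C → unitInterval)
    (f : Set C → Set A → ℝ) (g : Set C → Set B → ℝ) (h : Set C → Set A → Set B → ℝ)
    (hf0 : ∀ c a, 0 ≤ f c a) (hfa : ∀ c, Monotone (f c)) (hfc : ∀ a, Monotone (fun c => f c a))
    (hg0 : ∀ c b, 0 ≤ g c b) (hgb : ∀ c, Monotone (g c)) (hgc : ∀ b, Monotone (fun c => g c b))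
    (hh0 : ∀ c a b, 0 ≤ h c a b) (hhc : ∀ a b, Monotone (fun c => h c a b))
    (hha : ∀ c b, Monotone (fun a => h c a b)) (hhb : ∀ c a, Monotone (h c a)) :
    0 ≤ sahiE (fun q : Set A × Set B × Set C =>
        bernoulliWeight pA q.1 * bernoulliWeight pB q.2.1 * bernoulliWeight pC q.2.2) 3
        ![fun q => f q.2.2 q.1, fun q => g q.2.2 q.2.1, fun q => h q.2.2 q.1 q.2.1] :=
  sahiE_three_nonneg_sharedTwoPoint (isFKGMeasure_bernoulliWeight pA) (isFKGMeasure_bernoulliWeight pB)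
    (isFKGMeasure_bernoulliWeight pC).nonneg (isFKGMeasure_bernoulliWeight pC).sum_eq_one (Set.empty_subset (Set.univ : Set C))
    (fun c hc0 hc1 => absurd (c.eq_empty_or_nonempty.elim id fun hne => absurd (Subsingleton.eq_univ_of_nonempty hne) hc1) hc0)
    hf0 hfa hfc hg0 hgb hgc hh0 hhc hha hhb

end Cubes

end SahiSharedTwoPoint

end Summit.CriticalPhenomena.PercolationContinuityZ3.Theorems
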